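import Literature.Computability.Complexity.Counting
import Literature.Computability.Complexity.CodeFPStrings
import Literature.Computability.Complexity.LundEtAl1992Proofs
import Literature.Computability.AlgebraicComplexity.PermanentBitsPPoly
import Mathlib.LinearAlgebra.Matrix.Permanent
import Mathlib.Data.Fintype.Perm
import Mathlib.Data.List.GetD

/-!
# Route PermanentDescent, crux `PermanentNotInP` (stmt-PneNP-16143), line `Sketch` (xp-ladder) —
# calibration `perm ∈ #P`: the 0/1 permanent is a witness count of a polynomial-time relation

Registered side stub `stub_permSharpP` of the continuation c2 of the line `Sketch`: there is a
language `V ∈ P` such that for every square word `s` (`|s| = n²`, row-major 0/1 matrix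
`M_s(a, b) = s[b + n·a]`), every bit index `i` and every tag `t`, the number of strings
`y ∈ {0,1}^{|⟨s, bin i⟩|}` with `⟨⟨⟨s, bin i⟩, t⟩, y⟩ ∈ V` is exactly `perm_ℕ(M_s)` — Valiant's
`perm ∈ #P` [cite: Valiant1979, §2] in the exact shape (`countWitnesses V |x| (boolPair x t)`,
`x = ⟨s, bin i⟩`) consumed by the tree's binary search `BinSearchPP.countsLang_mem_PRelClass_PP`
(the neighbouring stub `stub_permBits_mem_PRelClass_PP_of_sharpP` turns it into `PermBits ∈ P^{PP}`).

The witnesses. `z = ⟨⟨x, t⟩, y⟩` is accepted iff, with `s := fstF (fstF (fstF z))`, `y := sndF z`,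
`n := √|s|`: every row `a < n` and every column `b < n` of the `n × n` bit array `y[b + n·a]` carries
exactly one `1` (a permutation matrix), that matrix is entrywise below `M_s`, and every bit of `y` at a
position `≥ n²` is `0` (canonical padding, so that the count is exact). §1 puts this test in the typed
polynomial-time calculus `CodeFP` (bounded `all`/`map`/`sum` loops over unary ranges, bit access
`strGetDNat`), whence `V ∈ P` by `LFKN.setOf_codeFP_mem_P`. §2–§3 count the accepted `y ∈ {0,1}^m`
(`m ≥ n²`): they are exactly the zero-padded one-hot codes `y_σ` (`y_σ[b + n·σ(b)] = 1` for the
columns `b < n`, all other bits `0`) of the permutations `σ` of `Fin n` supported by the matrix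
(`M_s(σ b, b) = 1` for all `b`; completeness `oneHot_passes`, soundness `perm_of_passes`,
injectivity by `index_inj`), and `#{σ | ∀ b, M_s(σ b, b) = 1} = perm_ℕ(M_s)` is the tree's
`permanent_of_bool` [cite: Valiant1979, §1].
§4 is the registered signature, by name, in `namespace Summit.PneNP.PneNP.Theorems.XpLadder`.

Lead prover-line-stmt-PneNP-16143-c2-0 (continuation c2), `--supports stmt-PneNP-16143`.
-/

set_option linter.dupNamespace false -- `Summit.PneNP.PneNP.…`: summit = sub-problem name (D-0017 single-conjunct layout)

namespace Summit.PneNP.PneNP.Theorems.XpLadder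

open _root_.Computability Literature.Computability.Complexity Literature.Computability.Complexity.Brick
  Literature.Computability.Complexity.CodeFP

/-! ### §1 The witness test in the typed polynomial-time calculus `CodeFP` -/

/-- **Bounded `all` over a computed unary range, with a context.**
[cite: AroraBarak2009, §1.3 (polynomially bounded loops)] -/
theorem allRange_codeFP {σ : Type} {eσ : σ → List Bool} {N : σ → ℕ} {P : σ × ℕ → Bool}
    (hN : CodeFP eσ unE N) (hP : CodeFP (pairE eσ natE) bitE P) :
    CodeFP eσ bitE (fun c => (List.range (N c)).all fun a => P (c, a)) :=
  ((CodeFP.all hP).comp ((CodeFP.id eσ).pair (urange.comp hN))).congr fun _ => rfl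

/-- **Bounded sums over a computed unary range, with a context.**
[cite: AroraBarak2009, §1.3 (polynomially bounded loops)] -/
theorem sumRange_codeFP {σ : Type} {eσ : σ → List Bool} {N : σ → ℕ} {F : σ × ℕ → ℕ}
    (hN : CodeFP eσ unE N) (hF : CodeFP (pairE eσ natE) natE F) :
    CodeFP eσ natE (fun c => ((List.range (N c)).map fun a => F (c, a)).sum) :=
  (natSum.comp ((CodeFP.map hF).comp ((CodeFP.id eσ).pair (urange.comp hN)))).congr fun _ => rfl

/-- **The one-hot permutation test is polynomial time on codes.** For accessors `S`, `Y` (strings)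
and `N` (a side length, available in binary and — together with its square — in unary) computed on
codes, the test "every row and every column `< N z` of the bit array `(Y z)[b + N z · a]` has exactly
one `1`, the array is entrywise below `S z` on the first `(N z)²` positions, and `Y z` vanishes from
position `(N z)²` on" is a `CodeFP` bit. [cite: AroraBarak2009, §1.3] -/
theorem oneHotPermTest_codeFP {S Y : List Bool → List Bool} {N : List Bool → ℕ}
    (hS : CodeFP strE strE S) (hY : CodeFP strE strE Y) (hN : CodeFP strE natE N)
    (hNU : CodeFP strE unE N) (hNNU : CodeFP strE unE fun z => N z * N z) :
    CodeFP strE bitE (fun z =>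
      ((List.range (N z)).all fun a => decide ((((List.range (N z)).map fun b =>
          if (Y z).getD (b + N z * a) false then (1 : ℕ) else 0)).sum = 1)) &&
      (((List.range (N z)).all fun b => decide ((((List.range (N z)).map fun a =>
          if (Y z).getD (b + N z * a) false then (1 : ℕ) else 0)).sum = 1)) &&
        (((List.range (N z * N z)).all fun j => !(Y z).getD j false || (S z).getD j false) &&
          ((List.range (Y z).length).all fun j =>
            decide (j < N z * N z) || !(Y z).getD j false)))) := by
  -- level 2: context `((z, outer index), inner index)`
  have hz₂ : CodeFP (pairE (pairE strE natE) natE) strE (fun r => r.1.1) := (fst _ _).fst'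
  have ho₂ : CodeFP (pairE (pairE strE natE) natE) natE (fun r => r.1.2) := (fst _ _).snd'
  have hi₂ : CodeFP (pairE (pairE strE natE) natE) natE (fun r => r.2) := snd _ _
  have hrowBit : CodeFP (pairE (pairE strE natE) natE) bitE
      (fun r => (Y r.1.1).getD (r.2 + N r.1.1 * r.1.2) false) :=
    strGetDNat.comp ((hY.comp hz₂).pair (natAdd.comp (hi₂.pair (natMul.comp ((hN.comp hz₂).pair ho₂)))))
  have hcolBit : CodeFP (pairE (pairE strE natE) natE) bitE
      (fun r => (Y r.1.1).getD (r.1.2 + N r.1.1 * r.2) false) :=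
    strGetDNat.comp ((hY.comp hz₂).pair (natAdd.comp (ho₂.pair (natMul.comp ((hN.comp hz₂).pair hi₂)))))
  have hrow : CodeFP (pairE (pairE strE natE) natE) natE
      (fun r => if (Y r.1.1).getD (r.2 + N r.1.1 * r.1.2) false then (1 : ℕ) else 0) :=
    hrowBit.ite (const _ (1 : ℕ)) (const _ (0 : ℕ))
  have hcol : CodeFP (pairE (pairE strE natE) natE) natE
      (fun r => if (Y r.1.1).getD (r.1.2 + N r.1.1 * r.2) false then (1 : ℕ) else 0) :=
    hcolBit.ite (const _ (1 : ℕ)) (const _ (0 : ℕ))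
  -- level 1: context `(z, index)`
  have hNU₁ : CodeFP (pairE strE natE) unE (fun q => N q.1) := hNU.comp (fst _ _)
  have hR : CodeFP (pairE strE natE) bitE (fun q => decide ((((List.range (N q.1)).map fun b =>
      if (Y q.1).getD (b + N q.1 * q.2) false then (1 : ℕ) else 0)).sum = 1)) :=
    natEq.comp ((sumRange_codeFP hNU₁ hrow).pair (const _ 1))
  have hC : CodeFP (pairE strE natE) bitE (fun q => decide ((((List.range (N q.1)).map fun a =>
      if (Y q.1).getD (q.2 + N q.1 * a) false then (1 : ℕ) else 0)).sum = 1)) :=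
    natEq.comp ((sumRange_codeFP hNU₁ hcol).pair (const _ 1))
  have hyj : CodeFP (pairE strE natE) bitE (fun q => (Y q.1).getD q.2 false) :=
    strGetDNat.comp ((hY.comp (fst _ _)).pair (snd _ _))
  have hsj : CodeFP (pairE strE natE) bitE (fun q => (S q.1).getD q.2 false) :=
    strGetDNat.comp ((hS.comp (fst _ _)).pair (snd _ _))
  have hlt : CodeFP (pairE strE natE) bitE (fun q => decide (q.2 < N q.1 * N q.1)) :=
    natLt.comp ((snd _ _).pair ((natOfUn.comp hNNU).comp (fst _ _)))
  exact (allRange_codeFP hNU hR).and ((allRange_codeFP hNU hC).and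
    ((allRange_codeFP hNNU (hyj.not.or hsj)).and (allRange_codeFP (strLength.comp hY) (hlt.or hyj.not))))

/-! ### §2 Row-major indices and one-hot codes of permutations -/

/-- `b + n·a < n²` for `a, b < n`. [folklore] -/
theorem index_lt {n a b : ℕ} (ha : a < n) (hb : b < n) : b + n * a < n * n := by
  calc b + n * a < n + n * a := by omega
    _ = n * (a + 1) := by ring
    _ ≤ n * n := Nat.mul_le_mul_left n ha

/-- Row-major indices determine their coordinates (Euclidean division by `n`). [folklore] -/
theorem index_inj {n b b' a a' : ℕ} (hb : b < n) (hb' : b' < n) :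
    b + n * a = b' + n * a' ↔ b = b' ∧ a = a' := by
  refine ⟨fun h => ?_, fun h => by rw [h.1, h.2]⟩
  have hn : 0 < n := by omega
  have h1 : (b + n * a) % n = (b' + n * a') % n := by rw [h]
  have h2 : (b + n * a) / n = (b' + n * a') / n := by rw [h]
  rw [Nat.add_mul_mod_self_left, Nat.add_mul_mod_self_left, Nat.mod_eq_of_lt hb,
    Nat.mod_eq_of_lt hb'] at h1
  rw [Nat.add_mul_div_left _ _ hn, Nat.add_mul_div_left _ _ hn, Nat.div_eq_of_lt hb,
    Nat.div_eq_of_lt hb'] at h2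
  exact ⟨h1, by simpa using h2⟩

/-- **The one-hot code of a map `f : Fin n → Fin n`** (bit `b + n·f(b)` set for every column `b`)
has bit `b + n·a` set iff `f b = a`. [folklore] -/
theorem oneHot_iff {n : ℕ} (f : Fin n → Fin n) {a b : ℕ} (ha : a < n) (hb : b < n) :
    (∃ c : Fin n, (c : ℕ) + n * (f c : ℕ) = b + n * a) ↔ f ⟨b, hb⟩ = ⟨a, ha⟩ := by
  constructor
  · rintro ⟨c, hc⟩
    obtain ⟨h1, h2⟩ := (index_inj c.2 hb).1 hc
    obtain rfl : c = ⟨b, hb⟩ := Fin.ext h1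
    exact Fin.ext h2
  · intro h
    exact ⟨⟨b, hb⟩, by rw [h]⟩

/-- The one-hot code of a map `Fin n → Fin n` has no bit set at positions `≥ n²`. [folklore] -/
theorem oneHot_false {n : ℕ} (f : Fin n → Fin n) {j : ℕ} (hj : n * n ≤ j) :
    ¬ ∃ c : Fin n, (c : ℕ) + n * (f c : ℕ) = j := by
  rintro ⟨c, hc⟩
  have := index_lt (f c).2 c.2
  omega

/-- Bit access in a `map` over `List.range m` (`false` past the end). [folklore] -/
theorem getD_map_range (m j : ℕ) (f : ℕ → Bool) :
    ((List.range m).map f).getD j false = (decide (j < m) && f j) := by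
  by_cases h : j < m
  · rw [List.getD_eq_getElem _ _ (by simpa using h), List.getElem_map, List.getElem_range,
      decide_eq_true h, Bool.true_and]
  · rw [List.getD_eq_default _ _ (by simpa using Nat.le_of_not_lt h), decide_eq_false h,
      Bool.false_and]

/-- The indicator sum over `List.range n` is the size of the filtered `Finset.range n`. [folklore] -/
theorem sum_map_range_ite (n : ℕ) (q : ℕ → Bool) :
    ((List.range n).map fun k => if q k then (1 : ℕ) else 0).sum =
      ((Finset.range n).filter fun k => q k = true).card := by
  rw [Finset.card_filter]
  induction n with
  | zero => simp
  | succ n ih => rw [List.sum_range_succ, Finset.sum_range_succ, ih]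

/-- A filtered range of size one has a unique member. [folklore] -/
theorem existsUnique_of_card_eq_one {n : ℕ} {q : ℕ → Bool}
    (h : ((Finset.range n).filter fun k => q k = true).card = 1) :
    ∃ k, k < n ∧ q k = true ∧ ∀ k', k' < n → q k' = true → k' = k := by
  obtain ⟨k, hk⟩ := Finset.card_eq_one.1 h
  have hmem : ∀ k', (k' < n ∧ q k' = true) ↔ k' = k := fun k' => by
    simpa only [Finset.mem_filter, Finset.mem_range, Finset.mem_singleton] using Finset.ext_iff.1 hk k'
  exact ⟨k, ((hmem k).2 rfl).1, ((hmem k).2 rfl).2, fun k' hk' hq => (hmem k').1 ⟨hk', hq⟩⟩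

/-- A filtered range whose membership is `· = k` for some `k < n` has size one. [folklore] -/
theorem card_eq_one_of_unique {n k : ℕ} {q : ℕ → Bool} (hk : k < n)
    (hq : ∀ k', k' < n → (q k' = true ↔ k' = k)) :
    ((Finset.range n).filter fun k => q k = true).card = 1 := by
  refine Finset.card_eq_one.2 ⟨k, Finset.ext fun k' => ?_⟩
  simp only [Finset.mem_filter, Finset.mem_range, Finset.mem_singleton]
  exact ⟨fun h => (hq k' h.1).1 h.2, fun h => ⟨h ▸ hk, (hq k' (h ▸ hk)).2 h⟩⟩

/-! ### §3 The accepted witnesses are the one-hot codes of the supported permutations -/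

/-- **Completeness**: the (zero-padded) one-hot code of a permutation `σ` supported by the word
matrix (`s[b + n·σ(b)] = 1` for all `b`) passes the test — every row and column has exactly one `1`,
the `1`s lie below `M_s`, nothing is set from position `n²` on. [cite: Valiant1979, §2] -/
theorem oneHot_passes {n m : ℕ} {s y : List Bool} (hm : n * n ≤ m) (σ : Equiv.Perm (Fin n))
    (hs : ∀ i : Fin n, s.getD ((i : ℕ) + n * (σ i : ℕ)) false = true)
    (hy : ∀ j, y.getD j false =
      (decide (j < m) && decide (∃ c : Fin n, (c : ℕ) + n * (σ c : ℕ) = j))) :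
    (∀ a, a < n → ((Finset.range n).filter fun b => y.getD (b + n * a) false = true).card = 1) ∧
    (∀ b, b < n → ((Finset.range n).filter fun a => y.getD (b + n * a) false = true).card = 1) ∧
    (∀ j, j < n * n → y.getD j false = true → s.getD j false = true) ∧
    (∀ j, n * n ≤ j → y.getD j false = false) := by
  have hbit : ∀ {a b : ℕ} (ha : a < n) (hb : b < n),
      y.getD (b + n * a) false = true ↔ σ ⟨b, hb⟩ = ⟨a, ha⟩ := by
    intro a b ha hb
    rw [hy, Bool.and_eq_true, decide_eq_true_iff, decide_eq_true_iff, oneHot_iff σ ha hb]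
    exact and_iff_right (lt_of_lt_of_le (index_lt ha hb) hm)
  refine ⟨fun a ha => ?_, fun b hb => ?_, fun j _ h => ?_, fun j hj => ?_⟩
  · refine card_eq_one_of_unique (σ.symm ⟨a, ha⟩).2 fun b hb => ?_
    rw [hbit ha hb, ← Equiv.eq_symm_apply, Fin.ext_iff]
  · refine card_eq_one_of_unique (σ ⟨b, hb⟩).2 fun a ha => ?_
    rw [hbit ha hb, Fin.ext_iff]
    exact eq_comm
  · rw [hy, Bool.and_eq_true, decide_eq_true_iff, decide_eq_true_iff] at h
    obtain ⟨c, hc⟩ := h.2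
    rw [← hc]
    exact hs c
  · rw [hy, decide_eq_false (oneHot_false σ hj), Bool.and_false]

/-- **Soundness**: a string passing the test IS the zero-padded one-hot code of a permutation
supported by the word matrix (the column map `b ↦` the unique `a` with `y[b + n·a] = 1` is injective
by the row condition, hence a permutation of `Fin n`). [cite: Valiant1979, §2] -/
theorem perm_of_passes {n : ℕ} {s y : List Bool}
    (hR : ∀ a, a < n → ((Finset.range n).filter fun b => y.getD (b + n * a) false = true).card = 1)
    (hC : ∀ b, b < n → ((Finset.range n).filter fun a => y.getD (b + n * a) false = true).card = 1)
    (hD : ∀ j, j < n * n → y.getD j false = true → s.getD j false = true)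
    (hZ : ∀ j, n * n ≤ j → y.getD j false = false) :
    ∃ σ : Equiv.Perm (Fin n), (∀ i : Fin n, s.getD ((i : ℕ) + n * (σ i : ℕ)) false = true) ∧
      ∀ j, y.getD j false = decide (∃ c : Fin n, (c : ℕ) + n * (σ c : ℕ) = j) := by
  have hcol : ∀ b : Fin n, ∃ a : Fin n, y.getD (b + n * a) false = true ∧
      ∀ a' : Fin n, y.getD (b + n * a') false = true → a' = a := fun b => by
    obtain ⟨a, ha, hq, hu⟩ := existsUnique_of_card_eq_one (hC b b.2)
    exact ⟨⟨a, ha⟩, hq, fun a' h => Fin.ext (hu a' a'.2 h)⟩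
  choose g hg hgu using hcol
  have hginj : Function.Injective g := fun b b' hbb' => by
    obtain ⟨b₀, -, -, hu⟩ := existsUnique_of_card_eq_one (hR (g b) (g b).2)
    have h1 : (b : ℕ) = b₀ := hu b b.2 (hg b)
    have h2 : (b' : ℕ) = b₀ := hu b' b'.2 (by rw [hbb']; exact hg b')
    exact Fin.ext (h1.trans h2.symm)
  refine ⟨Equiv.ofBijective g hginj.bijective_of_finite,
    fun i => hD _ (index_lt (g i).2 i.2) (hg i), fun j => ?_⟩
  simp only [Equiv.ofBijective_apply]
  by_cases hj : j < n * n
  · have hn : 0 < n := Nat.pos_of_ne_zero fun h => by simp [h] at hj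
    obtain ⟨b, a, hb, ha, rfl⟩ : ∃ b a, b < n ∧ a < n ∧ j = b + n * a :=
      ⟨j % n, j / n, Nat.mod_lt j hn, (Nat.div_lt_iff_lt_mul hn).2 hj, (Nat.mod_add_div j n).symm⟩
    rw [Bool.eq_iff_iff, decide_eq_true_iff, oneHot_iff g ha hb]
    constructor
    · intro h
      exact (hgu ⟨b, hb⟩ ⟨a, ha⟩ h).symm
    · intro h
      have := hg ⟨b, hb⟩
      rw [h] at this
      exact this
  · rw [hZ j (Nat.le_of_not_lt hj), eq_comm, decide_eq_false_iff_not]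
    exact oneHot_false g (Nat.le_of_not_lt hj)

/-- **The count.** If membership of `⟨x, y⟩` in `V` is the one-hot permutation test for the square
word `s` of side `n` and `n² ≤ m`, then the number of `y ∈ {0,1}^m` with `⟨x, y⟩ ∈ V` is the permanent
over `ℕ` of the row-major 0/1 matrix `M_s` (bijection with the permutations `σ` of `Fin n` with
`M_s(σ b, b) = 1` for all `b`, counted by the tree's `permanent_of_bool`).
[cite: Valiant1979, §2] [cite: AroraBarak2009, Def. 17.2] -/
theorem countWitnesses_eq_permanent {V : Language Bool} {x : List Bool} {n m : ℕ} {s : List Bool}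
    (hm : n * n ≤ m)
    (hV : ∀ y : List Bool, boolPair x y ∈ V ↔
      (((List.range n).all fun a => decide ((((List.range n).map fun b =>
          if y.getD (b + n * a) false then (1 : ℕ) else 0)).sum = 1)) &&
        (((List.range n).all fun b => decide ((((List.range n).map fun a =>
            if y.getD (b + n * a) false then (1 : ℕ) else 0)).sum = 1)) &&
          (((List.range (n * n)).all fun j => !y.getD j false || s.getD j false) &&
            ((List.range y.length).all fun j => decide (j < n * n) || !y.getD j false)))) = true) :
    countWitnesses V m x =
      (Matrix.of fun a b : Fin n => if s.getD ((b : ℕ) + n * (a : ℕ)) false then (1 : ℕ) else 0).permanent := by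
  rw [show (Matrix.of fun a b : Fin n =>
      if s.getD ((b : ℕ) + n * (a : ℕ)) false then (1 : ℕ) else 0).permanent =
        Literature.Computability.AlgebraicComplexity.permCount n
          (fun ij : Fin n × Fin n => s.getD ((ij.2 : ℕ) + n * (ij.1 : ℕ)) false) from
    Literature.Computability.AlgebraicComplexity.permanent_of_bool ℕ n
      fun ij : Fin n × Fin n => s.getD ((ij.2 : ℕ) + n * (ij.1 : ℕ)) false]
  unfold countWitnesses Literature.Computability.AlgebraicComplexity.permCount
  symm
  classical
  refine Finset.card_bij (fun σ _ => (⟨(List.range m).map fun j =>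
      decide (∃ c : Fin n, (c : ℕ) + n * (σ c : ℕ) = j), by simp⟩ : List.Vector Bool m))
    (fun σ hσ => ?_) (fun σ₁ _ σ₂ _ h => ?_) (fun w hw => ?_)
  · -- the one-hot code of a supported permutation is accepted
    obtain ⟨hR, hC, hD, hZ⟩ := oneHot_passes hm σ (Finset.mem_filter.1 hσ).2
      (y := List.Vector.toList (⟨(List.range m).map fun j =>
        decide (∃ c : Fin n, (c : ℕ) + n * (σ c : ℕ) = j), by simp⟩ : List.Vector Bool m))
      fun j => getD_map_range _ _ _
    refine Finset.mem_filter.2 ⟨Finset.mem_univ _, (hV _).2 ?_⟩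
    simp only [Bool.and_eq_true, List.all_eq_true, List.mem_range, decide_eq_true_eq,
      Bool.or_eq_true, Bool.not_eq_true', sum_map_range_ite]
    exact ⟨hR, hC, fun j hj => (Bool.eq_false_or_eq_true _).symm.imp_right (hD j hj),
      fun j _ => (Nat.lt_or_ge j (n * n)).imp_right (hZ j)⟩
  · -- distinct permutations have distinct codes
    have hl : ((List.range m).map fun j => decide (∃ c : Fin n, (c : ℕ) + n * (σ₁ c : ℕ) = j)) =
        (List.range m).map fun j => decide (∃ c : Fin n, (c : ℕ) + n * (σ₂ c : ℕ) = j) :=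
      congrArg List.Vector.toList h
    refine Equiv.ext fun b => ?_
    have hj : (b : ℕ) + n * (σ₁ b : ℕ) < m := lt_of_lt_of_le (index_lt (σ₁ b).2 b.2) hm
    have h1 := congrArg (fun l => l.getD ((b : ℕ) + n * (σ₁ b : ℕ)) false) hl
    simp only [getD_map_range, hj, decide_true, Bool.true_and] at h1
    rw [Bool.eq_iff_iff, decide_eq_true_iff, decide_eq_true_iff] at h1
    obtain ⟨c, hc⟩ := h1.1 ⟨b, rfl⟩
    obtain ⟨hcb, hσ⟩ := (index_inj c.2 b.2).1 hc
    obtain rfl : c = b := Fin.ext hcb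
    exact (Fin.ext hσ).symm
  · -- every accepted string is such a code
    have hw' := (hV _).1 (Finset.mem_filter.1 hw).2
    simp only [Bool.and_eq_true, List.all_eq_true, List.mem_range, decide_eq_true_eq,
      Bool.or_eq_true, Bool.not_eq_true', sum_map_range_ite] at hw'
    obtain ⟨hR, hC, hD, hZ⟩ := hw'
    obtain ⟨σ, hσ, hword⟩ := perm_of_passes hR hC
      (fun j hj h => (hD j hj).resolve_left (by rw [h]; decide))
      (fun j hj => (Nat.lt_or_ge j w.toList.length).elim
        (fun hjl => (hZ j hjl).resolve_left (Nat.not_lt.2 hj))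
        (fun hjl => List.getD_eq_default _ _ hjl))
    refine ⟨σ, Finset.mem_filter.2 ⟨Finset.mem_univ _, hσ⟩, List.Vector.eq _ _ ?_⟩
    rw [List.Vector.toList_mk]
    refine List.ext_getElem (by simp) fun j h₁ h₂ => ?_
    rw [List.getElem_map, List.getElem_range, ← List.getD_eq_getElem _ false h₂, hword j]

/-! ### §4 The registered stub -/

/-- Membership in a language cut out by a predicate (the `Language` copy of `Set.mem_setOf_eq`).
[folklore] -/
theorem mem_language_setOf {p : List Bool → Prop} {w : List Bool} :
    Membership.mem (γ := Language Bool) {z | p z} w ↔ p w :=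
  Iff.rfl

/-- **Registered stub `stub_permSharpP` of the line `Sketch` (crux stmt-PneNP-16143): the 0/1
permanent is a witness count of a polynomial-time relation.** There is `V ∈ P` such that for every
square word `s` (`|s| = n²`), every bit index `i` and every tag `t`, the number of
`y ∈ {0,1}^{|⟨s, bin i⟩|}` with `⟨⟨⟨s, bin i⟩, t⟩, y⟩ ∈ V` is `perm_ℕ(M_s)`: `V` is cut out by the
one-hot permutation test of §1 (read off `s = fstF (fstF (fstF z))`, `y = sndF z`, `n = √|s|`), in
`P` by `LFKN.setOf_codeFP_mem_P`, and the count is `countWitnesses_eq_permanent`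
(`|⟨s, bin i⟩| = 2n² + 2 + |bin i| ≥ n²`). [cite: Valiant1979, §2] [cite: AroraBarak2009, Def. 17.2] -/
theorem stub_permSharpP :
    ∃ V : Language Bool, V ∈ Literature.Computability.Complexity.Classes.P ∧
      ∀ (n : ℕ) (s : List Bool) (i : ℕ) (t : List Bool), s.length = n * n →
        Literature.Computability.Complexity.countWitnesses V
            (Literature.Computability.Complexity.boolPair s (Computability.encodeNat i)).length
            (Literature.Computability.Complexity.boolPair
              (Literature.Computability.Complexity.boolPair s (Computability.encodeNat i)) t) =
          Matrix.permanent (Matrix.of fun a b : Fin n =>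
            if s.getD ((b : ℕ) + n * (a : ℕ)) false then (1 : ℕ) else 0) := by
  -- the accessors `s = fstF (fstF (fstF z))`, `y = sndF z`, `n = √|s|` (binary, unary; `n² ≤ |s|`)
  have hf : CodeFP strE strE fstF := of_fn fstF fstF_mem_FP fun _ => rfl
  have hS : CodeFP strE strE (fun z => fstF (fstF (fstF z))) := hf.comp (hf.comp hf)
  have hY : CodeFP strE strE sndF := of_fn sndF sndF_mem_FP fun _ => rfl
  have hLU : CodeFP strE unE (fun z => (fstF (fstF (fstF z))).length) := strLength.comp hS
  have hL : CodeFP strE natE (fun z => (fstF (fstF (fstF z))).length) := (natOfUn.comp hLU :)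
  have hN : CodeFP strE natE (fun z => Nat.sqrt (fstF (fstF (fstF z))).length) := natSqrt.comp hL
  have hNU : CodeFP strE unE (fun z => Nat.sqrt (fstF (fstF (fstF z))).length) :=
    (unOfNatMin.comp (hLU.pair hN)).congr fun z => min_eq_left (Nat.sqrt_le_self _)
  have hNNU : CodeFP strE unE (fun z =>
      Nat.sqrt (fstF (fstF (fstF z))).length * Nat.sqrt (fstF (fstF (fstF z))).length) :=
    (unOfNatMin.comp (hLU.pair (natMul.comp (hN.pair hN)))).congr fun z => min_eq_left (Nat.sqrt_le _)
  refine ⟨_, LFKN.setOf_codeFP_mem_P (oneHotPermTest_codeFP hS hY hN hNU hNNU), fun n s i t hs => ?_⟩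
  refine countWitnesses_eq_permanent (by rw [length_boolPair, hs]; generalize n * n = k; omega)
    fun y => ?_
  rw [mem_language_setOf]
  simp only [fstF_boolPair, sndF_boolPair, hs, Nat.sqrt_eq]

end Summit.PneNP.PneNP.Theorems.XpLadder
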